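import Summits.QuantumFields.YangMills.Theorems.BalabanUVNodesN11TkBranchMassBound
import Summits.QuantumFields.YangMills.Theorems.BalabanUVNodesN11FluctTruncationGraph

/-!
# DAG node N11 — THE LAST BINDER `hIB` OF THE NO-EXPANSION 𝐓-STEP, IN THE RECORD's VOCABULARY: the old branches of record are `dU_k`-integrable as soon as
# (i) the history's residual 𝐓-weight factor `ζ0` obeys its laws and print's partition of unity and is measurable with `quad` (at `rePinH θ`: ALL DISCHARGED),
# (ii) each generation's A-fibre weight `χ_A · e^{−½ quad}` is dominated by an integrable function of the fluctuation variables it integrates (a row for the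
# VALUE of the residual's `quad`, node00-def-K0b), and (iii) the §2 operand of the witness is measurable and bounded on the multiscale configuration space (def-T)

HEADER — WORK-UNIT METADATA.  Cell `pub-ymgap`, YM-PLAN Track A (HUMAN RULING D-0062), seat `pub-ymgap-dag-n11-d` (g10; R134 fan-out seat N11 [B14], strategy s2),
route `BalabanUVNodes` rev 25, item K1⁷ `StabilityBAtRecordR13SepCoPH` = stmt-QuantumFields-20542 (helper, `--kind proof --supports 20542 --as helper`, count-neutral).
[III] = [Balaban1988Convergent].  Over this seat's g10 `…N11TkBranchMassBound` (★★★ `integrable_tkBranchOfRecord_baseCfg_of_dominated`), `…N11FluctTruncationGraph`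
(`exists_local_witness_clause_succ_rePinH_of_sLaw₁₃CoPH_of_graph`), g9 C2∕C3 (`measurable_WtOfRecord₁₃H_ζ∕_w`, `measurable_zhAt_ζ0_rePinH_of_provisos`,
`measurable_zhAt_quad_rePinH`), A2 (`rePinH θ`, `zhUnity_rePinH`, `provisos₁₃CoPH_rePinH`), def-T's v1.7 record `Node00.Record13CoPH` (`WtOfRecord₁₃H`, `Stage13HParams.zhAt`,
`ZhUnity`, `Provisos₁₃CoPH.zhLaws`, `WtOfRecord₁₃H_laws`).

WHY THIS FILE.  After the g10 files A∕B∕6 the off-diagonal residue of N11's no-expansion 𝐓-step is `hIB` — integrability of the old branches of the `SLaw` witness —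
and `…N11TkBranchMassBound` derives such integrability from STRUCTURAL laws on 11a's generic weight datum.  THIS FILE reads those laws off the RECORD: for
`W := WtOfRecord₁₃H θ p s′` the `ζ`-weights ARE the residual factor `ζ0` (12a″), nonnegative by the proviso row `zhLaws` and `≤ 1` by print's partition of unity
`ZhUnity` (§1); the A-weights are `χ_A(Y,S)·e^{−½ quad}` with 12a's `χ_A ∈ [0,1]` measurable.  What remains DISPLAYED is honest and addressed: a domination row on
the A-fibre weight (the Gaussian factor — [I]'s positivity of `𝒬`; the VALUE question of the residual's `quad`, K0b's) and the operand rows (def-T's term data).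
At the re-pinned parameter `rePinH θ` (§3) every residual row is a theorem (the certificate's `quad ≡ 0`, so its A-weights are `χ_A` itself — dominated exactly on
the branches without large-field cubes; the general branch needs the Gaussian `quad` of record, NOT claimed).

WHAT THIS FILE PROVES (0 `sorry`, 0 `def`).  §1 `zhAt_ζ0_le_one_of_unity`.  §5 A6 exhibit `sA_init_eq_empty_of_allLarge`, ★ `rows_of_allLarge` (on the
all-large diagonal both rows of §4 are inhabited for every witness).  §2 ★★ `integrable_oldBranch_of_dominated` (generic `θ : Stage13HParams`: rows (i)–(iii) ⇒
`hIB` for one old branch).  §3 ★★ `integrable_oldBranch_rePinH_of_dominated` (at `rePinH θ` from `Provisos₁₃CoPH`: rows (ii)–(iii) only).  §4 ★★★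
`exists_local_witness_clause_succ_rePinH_of_sLaw₁₃CoPH_of_dominated` — the `SLaw`-keyed WITNESS-FIRST face of the no-expansion 𝐓-step with `hIB` REPLACED by
rows (ii)–(iii) about the produced witness: D p569094's residue {hA, hΦm, hIB} is now {A-fibre domination (K0b), operand measurable + bounded (def-T)}.

HONEST FRAMING.  Helper lane of K1⁷; composition of accepted kernel bookkeeping; nothing of Bałaban's estimates is asserted; no law of record is edited or posited.
No binder quantifies over all term families.  N11 NOT discharged; K1⁷ NOT closed; counts unmoved (typed 28∕28 · discharged 5∕27).  One finite four-torus programme at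
fixed `ε = L^{−K}` — NOT ℝ⁴, NOT OS, NOT a mass gap, NOT Clay.  No `sorry`, `axiom`, `instance`, `notation`.
Sources (SHAPE only): [III] Theorem p.245, (2.18) p.257, (2.20)–(2.23) p.258, (3.16)–(3.21) pp.268–269, (3.23)–(3.25) p.270, Thm 1 p.262.
-/

noncomputable section

open MeasureTheory
open scoped BigOperators ENNReal NNReal Matrix.Norms.L2Operator

namespace Summit.QuantumFields.YangMills.Theorems.BalabanUVNodesN11OldBranchIntegrableOfDominated

open Literature.MathematicalPhysics.QuantumFieldTheory.Balaban1983to89 T4Continuum T4NestedCovariance Node00 Node00.Tk DagBinding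
open B15DeterminingSets
open BalabanUVNodesN11TkBranchMassBound (integrable_tkBranchOfRecord_baseCfg_of_dominated)
open BalabanUVNodesN11DiagonalOldBranchMeasurable (measurable_WtOfRecord₁₃H_ζ measurable_WtOfRecord₁₃H_w)
open BalabanUVNodesN11RePinnedOldBranchMeasurable (measurable_zhAt_ζ0_rePinH_of_provisos measurable_zhAt_quad_rePinH)
open BalabanUVNodesN11NoExpansionDiagonalCoPH (WtOfRecord₁₃H_eq_tkWeightsOfRecordP)
open BalabanUVNodesN11NoExpansionDiagonalAtZ (tkWeightsOfRecordP_ζ_apply)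
open BalabanUVNodesN11RePinnedParamDefs
open BalabanUVNodesN11FluctTruncationDefs
open BalabanUVNodesN11FluctTruncationGraph (exists_local_witness_clause_succ_rePinH_of_sLaw₁₃CoPH_of_graph)

variable {F : T4Family} {N : ℕ} [NeZero N]

/-! ## §1  Print's partition of unity bounds the residual factor by `1` -/

section Unity

variable (θ : Stage13HParams F N) (p : B12.RunParams)

/-- **`0 ≤ ζ0_j(Y) ≤ 1` FROM THE LAWS AND THE PARTITION OF UNITY**: a nonnegative family summing to `1` over the regions `Y` is termwise `≤ 1`.
[cite: Balaban1988Convergent, (3.16)–(3.20) pp.268–269 (bookkeeping)] -/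
theorem zhAt_ζ0_le_one_of_unity (hZ : ∀ (p : B12.RunParams) (n : ℕ) (Ω Λ : ℕ → Set (Site (F.P p.K) 0)), (θ.Zh p n Ω Λ).Laws) (hU : θ.ZhUnity F N) {n : ℕ}
    (s : SeqOfRecord F θ.ν θ.τ9.M (gOfRecord₁₃ F N θ.toStage13Params p) p.K n) (j : ℕ) (Y : Set (Site (F.P p.K) 0))
    (ω : MultiCfg (F.P p.K) (SU N) (FluctV N)) : (θ.zhAt p s).ζ0 j Y ω ≤ 1 := by
  have h1 := hU p n s.Ω s.Λ j ω
  have hle : (θ.Zh p n s.Ω s.Λ).ζ0 j Y ω ≤ ∑ᶠ Y' : Set (Site (F.P p.K) 0), (θ.Zh p n s.Ω s.Λ).ζ0 j Y' ω :=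
    single_le_finsum Y (Set.toFinite _) fun Y' => (hZ p n s.Ω s.Λ).zeta0_nonneg j Y' ω
  rw [h1] at hle
  exact hle

end Unity

/-! ## §2  ★★ `hIB` for one old branch of record, generic `θ`, from the structural rows -/

section Generic

variable (θ : Stage13HParams F N) (p : B12.RunParams)

/-- **★★ THE OLD BRANCH OF RECORD IS `dU_k`-INTEGRABLE FROM THE STRUCTURAL ROWS**, generic `θ : Stage13HParams`, any history `s′` of length `k+1`, any branch `S`, any
operand `Φ` of r11's shape: (i) residual rows — `zhLaws`, `ZhUnity`, measurability of `ζ0_j(Y)` and `quad_j(Λ′)` of the residual serving `s′`; (ii) A-fibre domination of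
the weights `χ_A(Y,S)·e^{−½quad}` of record by an integrable `ŵ_j` of the integrated fluctuation variables; (iii) `Φ` measurable on the multiscale configuration space with
`0 ≤ Φ ≤ CΦ`.  Then `U₀ ↦ 𝐓_k(init s′, S)[Φ](base_k U₀)` is integrable for product Haar (`…N11TkBranchMassBound` at `W := WtOfRecord₁₃H θ p s′`).
[cite: Balaban1988Convergent, (2.18) p.257, (2.20)–(2.21) p.258, (3.16)–(3.21) pp.268–269, (3.23)–(3.24) p.270] -/
theorem integrable_oldBranch_of_dominated
    (hZ : ∀ (p : B12.RunParams) (n : ℕ) (Ω Λ : ℕ → Set (Site (F.P p.K) 0)), (θ.Zh p n Ω Λ).Laws) (hU : θ.ZhUnity F N) {k : ℕ}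
    (s : SeqOfRecord F θ.ν θ.τ9.M (gOfRecord₁₃ F N θ.toStage13Params p) p.K (k + 1)) (S : ℕ → Set (Site (F.P p.K) 0))
    (hζm : ∀ j (Y : Set (Site (F.P p.K) 0)), Measurable ((θ.zhAt p s).ζ0 j Y))
    (hqm : ∀ j (Λ' : Set (Site (F.P p.K) 0)), Measurable ((θ.zhAt p s).quad j Λ'))
    (ŵ : (j : ℕ) → (↥(Set.toFinite (B10Eq42TorusConstraint.bondsIn j ((s.init.Λ (j + 1))ᶜ ∩ s.init.Ω (j + 1)))).toFinset → FluctV N) → ℝ≥0∞) (hŵm : ∀ j, Measurable (ŵ j)) (Cw : ℕ → ℝ≥0)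
    (hCw : ∀ j, ∫⁻ a, ŵ j a ∂(Measure.pi fun _ : ↥(Set.toFinite (B10Eq42TorusConstraint.bondsIn j ((s.init.Λ (j + 1))ᶜ ∩ s.init.Ω (j + 1)))).toFinset => (volume : Measure (FluctV N))) ≤ Cw j)
    (hdom : ∀ j ω, ENNReal.ofReal ((WtOfRecord₁₃H F N θ p s).w j (s.init.Λ (j + 1)) ((s.init.Λ (j + 1))ᶜ ∩ s.init.Ω (j + 1)) (S (j + 1)) ω) ≤
      ŵ j (fun b : ↥(Set.toFinite (B10Eq42TorusConstraint.bondsIn j ((s.init.Λ (j + 1))ᶜ ∩ s.init.Ω (j + 1)))).toFinset => (ω j).2 b))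
    {Φ : SFluct (F.P p.K) (FluctV N) → MSField (F.P p.K) (SU N) → ℝ}
    (hΦm : Measurable fun ω : MultiCfg (F.P p.K) (SU N) (FluctV N) => Φ (S, fun j => (ω j).2) (fun j => (ω j).1))
    (hΦ0 : ∀ a U, 0 ≤ Φ a U) (CΦ : ℝ) (hΦle : ∀ a U, Φ a U ≤ CΦ) :
    Integrable (fun U₀ : GaugeField (F.P p.K) k (SU N) =>
      tkBranchOfRecord F N (FluctV N) θ.ν θ.τ9.M _ p.K (WtOfRecord₁₃H F N θ p s) s.init S k
        (fun ω => Φ (S, fun j => (ω j).2) (fun j => (ω j).1)) (baseCfg (V := FluctV N) k U₀)) (fieldMeasure (F.P p.K) k (SU N)) := by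
  have hWlaws : (WtOfRecord₁₃H F N θ p s).Laws := WtOfRecord₁₃H_laws hZ p s
  refine integrable_tkBranchOfRecord_baseCfg_of_dominated θ.ν θ.τ9.M (gOfRecord₁₃ F N θ.toStage13Params p) p.K (WtOfRecord₁₃H F N θ p s) s.init S
    (fun j => measurable_WtOfRecord₁₃H_ζ θ p s j _ (hζm j _)) (fun j ω => hWlaws.zeta_nonneg j _ ω) (fun j ω => ?_)
    (fun j => measurable_WtOfRecord₁₃H_w θ p s j _ _ _ (hqm j _)) (fun j ω => TkWeights.w_nonneg hWlaws j _ _ _ ω) ŵ hŵm hdom Cw hCw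
    hΦm (fun ω => hΦ0 _ _) CΦ (fun ω => hΦle _ _) k
  -- `ζ_j(Y) = ζ0_j(Y) ≤ 1`
  rw [WtOfRecord₁₃H_eq_tkWeightsOfRecordP, tkWeightsOfRecordP_ζ_apply]
  exact zhAt_ζ0_le_one_of_unity θ p hZ hU s j _ ω

end Generic

/-! ## §3  ★★ At the re-pinned parameter: the residual rows are theorems -/

section RePinned

variable (θ : Stage13HParams F N) (p : B12.RunParams)

/-- **★★ AT `rePinH θ` THE OLD BRANCH OF RECORD IS `dU_k`-INTEGRABLE FROM THE A-FIBRE DOMINATION AND THE OPERAND ROWS ALONE**: the residual rows of §2 are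
discharged from `θ.Provisos₁₃CoPH` (`zhLaws` transported, measurability of `ζ0`∕`quad` by this seat's C3) and `zhUnity_rePinH` (unconditional).  (At `rePinH θ` the
certificate residual has `quad ≡ 0`, so its A-weights are 12a's `χ_A(Y, S)` — dominated by an integrable function of the integrated variables exactly when the branch
has no large-field cubes at that generation; the general branch needs the Gaussian `quad` of record, K0b's value — NOT claimed.)
[cite: Balaban1988Convergent, (2.18) p.257, (2.20)–(2.21) p.258, (3.16)–(3.21) pp.268–269, (3.23)–(3.24) p.270] -/
theorem integrable_oldBranch_rePinH_of_dominated (h : θ.Provisos₁₃CoPH F N) {k : ℕ}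
    (s : SeqOfRecord F θ.ν θ.τ9.M (gOfRecord₁₃ F N θ.toStage13Params p) p.K (k + 1)) (S : ℕ → Set (Site (F.P p.K) 0))
    (ŵ : (j : ℕ) → (↥(Set.toFinite (B10Eq42TorusConstraint.bondsIn j ((s.init.Λ (j + 1))ᶜ ∩ s.init.Ω (j + 1)))).toFinset → FluctV N) → ℝ≥0∞) (hŵm : ∀ j, Measurable (ŵ j)) (Cw : ℕ → ℝ≥0)
    (hCw : ∀ j, ∫⁻ a, ŵ j a ∂(Measure.pi fun _ : ↥(Set.toFinite (B10Eq42TorusConstraint.bondsIn j ((s.init.Λ (j + 1))ᶜ ∩ s.init.Ω (j + 1)))).toFinset => (volume : Measure (FluctV N))) ≤ Cw j)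
    (hdom : ∀ j ω, ENNReal.ofReal ((WtOfRecord₁₃H F N (rePinH θ) p s).w j (s.init.Λ (j + 1)) ((s.init.Λ (j + 1))ᶜ ∩ s.init.Ω (j + 1)) (S (j + 1)) ω) ≤
      ŵ j (fun b : ↥(Set.toFinite (B10Eq42TorusConstraint.bondsIn j ((s.init.Λ (j + 1))ᶜ ∩ s.init.Ω (j + 1)))).toFinset => (ω j).2 b))
    {Φ : SFluct (F.P p.K) (FluctV N) → MSField (F.P p.K) (SU N) → ℝ}
    (hΦm : Measurable fun ω : MultiCfg (F.P p.K) (SU N) (FluctV N) => Φ (S, fun j => (ω j).2) (fun j => (ω j).1))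
    (hΦ0 : ∀ a U, 0 ≤ Φ a U) (CΦ : ℝ) (hΦle : ∀ a U, Φ a U ≤ CΦ) :
    Integrable (fun U₀ : GaugeField (F.P p.K) k (SU N) =>
      tkBranchOfRecord F N (FluctV N) θ.ν θ.τ9.M _ p.K (WtOfRecord₁₃H F N (rePinH θ) p s) s.init S k
        (fun ω => Φ (S, fun j => (ω j).2) (fun j => (ω j).1)) (baseCfg (V := FluctV N) k U₀)) (fieldMeasure (F.P p.K) k (SU N)) :=
  integrable_oldBranch_of_dominated (rePinH θ) p (provisos₁₃CoPH_rePinH h).zhLaws (zhUnity_rePinH (θ := θ)) s S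
    (fun j Y => measurable_zhAt_ζ0_rePinH_of_provisos θ p h s j Y) (fun j Λ' => measurable_zhAt_quad_rePinH θ p s j Λ') ŵ hŵm Cw hCw hdom hΦm hΦ0 CΦ hΦle

end RePinned


/-! ## §4  ★★★ The `SLaw`-keyed witness-first face: `hIB` replaced by the two structural rows -/

section Witness

variable (θ : Stage13HParams F N) (p : B12.RunParams)

/-- **★★★ THE OFF-DIAGONAL NO-EXPANSION 𝐓-STEP AT `rePinH θ`, `SLaw`-KEYED, WITNESS FIRST, WITH THE LAST KERNEL-OPAQUE BINDER GONE**: from `SLaw₁₃CoPH (rePinH θ) p k`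
one obtains law-abiding, `k`-local term-value and constant families `(t, E_k)` carrying the level-`k` dichotomy, such that for EVERY history `s′` with `Ω_{k+1}(s′) = ∅`
the 𝐓-image clause at `s′` holds for `(t (init s′), E_k(init s′))` AS SOON AS, for every old branch `S`: (K0b's row) each generation's A-fibre weight of the
re-pinned weights serving `s′` is dominated by an integrable function of the integrated fluctuation variables, and (def-T's rows) the old operand
`ω ↦ exp A_k(init s′)(S, ·)(ω)` of THAT witness is measurable and bounded on the multiscale configuration space.  This is D p569094's residue {hA, hΦm, hIB} after the
three doors of this seat's g10: {A-fibre domination, operand measurable, operand bounded} — properties of the DATA, no iterated transport left.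
[cite: Balaban1988Convergent, Theorem p.245, Thm 1 p.262, (3.24)–(3.25) p.270, (2.18) p.257, (2.20)–(2.23) p.258, (3.16)–(3.21) pp.268–269] -/
theorem exists_local_witness_clause_succ_rePinH_of_sLaw₁₃CoPH_of_dominated (h : θ.Provisos₁₃CoPH F N) {k : ℕ} (hk : k < p.K) (hM : 1 ≤ θ.τ9.M)
    (hS : SLaw₁₃CoPH F N (rePinH θ) p k) :
    ∃ (t : SeqOfRecord F θ.ν θ.τ9.M (gOfRecord₁₃ F N θ.toStage13Params p) p.K k → Sect2.TermValues (F.P p.K) (MatA N) (FluctV N) θ.τ9.M)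
      (Ek : SeqOfRecord F θ.ν θ.τ9.M (gOfRecord₁₃ F N θ.toStage13Params p) p.K k → ℝ),
      HasSect2FormAtZS F N (FluctV N) p.K (settingOfRecord₁₃ F N θ.toStage13Params p) k (θ.rzAt p) (WtOfRecord₁₃H F N (rePinH θ) p)
          (UbgOfRecord₁₃CoP F N θ.toStage13Params p k)
          (fun s₀ t₀ => Sect2.LawsRT (sect2TowerOfRecord F N (FluctV N) p.K (settingOfRecord₁₃ F N θ.toStage13Params p) (θ.rzAt p s₀) s₀ t₀)
            (settingOfRecord₁₃ F N θ.toStage13Params p).lf k)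
          (slotsOfRecord F N θ.ν θ.τ9 (EOfRecord₁₃ F N θ.toStage13Params) (wOfRecord₉ F N θ.toStage9Params) θ.ppSel p
            (gOfRecord₁₃ F N θ.toStage13Params p) k) t Ek ∧
      (∀ s₀, IsFluctLocal k (t s₀)) ∧
      ∀ (s : SeqOfRecord F θ.ν θ.τ9.M (gOfRecord₁₃ F N θ.toStage13Params p) p.K (k + 1)), s.Ω (k + 1) = ∅ →
        -- (K0b's row) A-fibre domination of the re-pinned weights serving `s`, per old branch and generation
        (∀ S ∈ admSOfRecord F θ.ν θ.τ9.M (gOfRecord₁₃ F N θ.toStage13Params p) p.K k s.init, ∀ j : ℕ,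
          ∃ ŵ : (↥(Set.toFinite (B10Eq42TorusConstraint.bondsIn j ((s.init.Λ (j + 1))ᶜ ∩ s.init.Ω (j + 1)))).toFinset → FluctV N) → ℝ≥0∞, Measurable ŵ ∧
            (∫⁻ a, ŵ a ∂(Measure.pi fun _ : ↥(Set.toFinite (B10Eq42TorusConstraint.bondsIn j ((s.init.Λ (j + 1))ᶜ ∩ s.init.Ω (j + 1)))).toFinset => (volume : Measure (FluctV N)))) ≠ ⊤ ∧
            ∀ ω, ENNReal.ofReal ((WtOfRecord₁₃H F N (rePinH θ) p s).w j (s.init.Λ (j + 1)) ((s.init.Λ (j + 1))ᶜ ∩ s.init.Ω (j + 1)) (S (j + 1)) ω) ≤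
              ŵ (fun b : ↥(Set.toFinite (B10Eq42TorusConstraint.bondsIn j ((s.init.Λ (j + 1))ᶜ ∩ s.init.Ω (j + 1)))).toFinset => (ω j).2 b)) →
        -- (def-T's rows) the old operand of THIS witness is measurable and bounded on the multiscale configuration space
        (∀ S ∈ admSOfRecord F θ.ν θ.τ9.M (gOfRecord₁₃ F N θ.toStage13Params p) p.K k s.init,
          Measurable (fun ω : MultiCfg (F.P p.K) (SU N) (FluctV N) =>
            sect2Operand F N (FluctV N) p.K (settingOfRecord₁₃ F N θ.toStage13Params p) (θ.rzAt p s.init) s.init (t s.init) (Ek s.init)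
                (UbgOfRecord₁₃CoP F N θ.toStage13Params p k s.init) (S, fun j => (ω j).2) (fun j => (ω j).1)) ∧
          ∃ CΦ : ℝ, ∀ a U, sect2Operand F N (FluctV N) p.K (settingOfRecord₁₃ F N θ.toStage13Params p) (θ.rzAt p s.init) s.init (t s.init) (Ek s.init)
                (UbgOfRecord₁₃CoP F N θ.toStage13Params p k s.init) a U ≤ CΦ) →
        (slotsTOfRecord F N θ.ν θ.τ9 (EOfRecord₁₃ F N θ.toStage13Params) (wOfRecord₉ F N θ.toStage9Params) θ.ppSel p
            (gOfRecord₁₃ F N θ.toStage13Params p) (k + 1) s = 0 ∨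
          ∀ᵐ V' ∂fieldMeasure (F.P p.K) (k + 1) (SU N),
            chiSeqOfRecord F N θ.ν θ.τ9.M (gOfRecord₁₃ F N θ.toStage13Params p) p.K (k + 1) s V' ≠ 0 →
              slotsTOfRecord F N θ.ν θ.τ9 (EOfRecord₁₃ F N θ.toStage13Params) (wOfRecord₉ F N θ.toStage9Params) θ.ppSel p
                  (gOfRecord₁₃ F N θ.toStage13Params p) (k + 1) s V' =
                sect2Slot F N (FluctV N) p.K (settingOfRecord₁₃ F N θ.toStage13Params p) (θ.rzAt p s) (WtOfRecord₁₃H F N (rePinH θ) p s) s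
                  (t s.init) (Ek s.init) (UbgOfRecord₁₃CoP F N θ.toStage13Params p (k + 1) s) V') := by
  obtain ⟨t, Ek, hform, hloc, hstep⟩ := exists_local_witness_clause_succ_rePinH_of_sLaw₁₃CoPH_of_graph θ p h hk hM hS
  refine ⟨t, Ek, hform, hloc, fun s hΩ hW hΦ => hstep s hΩ fun S hSm => ?_⟩
  -- assemble the structural rows for the branch `S` and apply §3
  choose ŵ hŵm hŵfin hdom using hW S hSm
  obtain ⟨hΦm, CΦ, hΦle⟩ := hΦ S hSm
  refine integrable_oldBranch_rePinH_of_dominated θ p h s S ŵ hŵm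
    (fun j => (∫⁻ a, ŵ j a ∂(Measure.pi fun _ : ↥(Set.toFinite (B10Eq42TorusConstraint.bondsIn j ((s.init.Λ (j + 1))ᶜ ∩ s.init.Ω (j + 1)))).toFinset => (volume : Measure (FluctV N)))).toNNReal)
    (fun j => le_of_eq (ENNReal.coe_toNNReal (hŵfin j)).symm) hdom
    (Φ := sect2Operand F N (FluctV N) p.K (settingOfRecord₁₃ F N θ.toStage13Params p) (θ.rzAt p s.init) s.init (t s.init) (Ek s.init)
                (UbgOfRecord₁₃CoP F N θ.toStage13Params p k s.init)) hΦm (fun a U => (sect2Operand_pos p.K _ _ s.init (t s.init) (Ek s.init) _ a U).le) CΦ hΦle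

end Witness


/-! ## §5  A6 exhibit: along the all-large-field diagonal both rows ARE inhabited at `rePinH θ` -/

section Diagonal

variable (θ : Stage13HParams F N) (p : B12.RunParams)

/-- Along the all-large-field history the A-bond sets of every generation of `init s′` are EMPTY (`Ω_{j+1} = ∅`). [cite: Balaban1988Convergent, (2.1) p.254, (3.23) p.270 (bookkeeping)] -/
theorem sA_init_eq_empty_of_allLarge {k : ℕ} (s : SeqOfRecord F θ.ν θ.τ9.M (gOfRecord₁₃ F N θ.toStage13Params p) p.K (k + 1))
    (hall : ∀ j, 1 ≤ j → j ≤ k + 1 → s.Ω j = ∅) (j : ℕ) : (Set.toFinite (B10Eq42TorusConstraint.bondsIn j ((s.init.Λ (j + 1))ᶜ ∩ s.init.Ω (j + 1)))).toFinset = ∅ := by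
  have hΩ : s.init.Ω (j + 1) = ∅ := by
    by_cases hj : j + 1 ≤ k
    · exact BalabanUVNodesN11NoExpansionAllLargeCoP.init_allLarge θ.toStage13Params p s hall (j + 1) (by omega) hj
    · exact s.init.Ω_off (j + 1) (fun h' => hj h'.2)
  refine Finset.eq_empty_iff_forall_notMem.mpr fun b hb => ?_
  rw [Set.Finite.mem_toFinset, hΩ, Set.inter_empty] at hb
  exact hb.1

/-- **★ A6 EXHIBIT — THE TWO STRUCTURAL ROWS OF §4 HOLD ALONG THE ALL-LARGE-FIELD DIAGONAL AT `rePinH θ`**, for every term-value witness `t`, constant `E_k` and old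
branch `S`: (K0b's row) the A-fibres are one-point spaces (`sA_j = ∅`), dominated by `ŵ := 1` of mass `1`, the weights being `≤ 1` (`χ_A ≤ 1`, certificate `quad = 0`);
(def-T's rows) the operand is `exp(−g₀⁻²A((ω 0).1) − E_k)` — measurable (C2) and `≤ e^{−E_k}` (`wilsonAction4_nonneg`).  So §4 is not vacuous: on the diagonal it
re-proves the g9 closure. [cite: Balaban1988Convergent, (2.23) p.258, (3.23)–(3.24) p.270, Thm 1 p.262] -/
theorem rows_of_allLarge (h : θ.Provisos₁₃CoPH F N) (hM : 1 ≤ θ.τ9.M) {k : ℕ}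
    (s : SeqOfRecord F θ.ν θ.τ9.M (gOfRecord₁₃ F N θ.toStage13Params p) p.K (k + 1)) (hall : ∀ j, 1 ≤ j → j ≤ k + 1 → s.Ω j = ∅)
    (t : Sect2.TermValues (F.P p.K) (MatA N) (FluctV N) θ.τ9.M) (Ek : ℝ) (S : ℕ → Set (Site (F.P p.K) 0)) :
    (∀ j : ℕ, ∃ ŵ : (↥(Set.toFinite (B10Eq42TorusConstraint.bondsIn j ((s.init.Λ (j + 1))ᶜ ∩ s.init.Ω (j + 1)))).toFinset → FluctV N) → ℝ≥0∞, Measurable ŵ ∧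
        (∫⁻ a, ŵ a ∂(Measure.pi fun _ : ↥(Set.toFinite (B10Eq42TorusConstraint.bondsIn j ((s.init.Λ (j + 1))ᶜ ∩ s.init.Ω (j + 1)))).toFinset => (volume : Measure (FluctV N)))) ≠ ⊤ ∧
        ∀ ω, ENNReal.ofReal ((WtOfRecord₁₃H F N (rePinH θ) p s).w j (s.init.Λ (j + 1)) ((s.init.Λ (j + 1))ᶜ ∩ s.init.Ω (j + 1)) (S (j + 1)) ω) ≤
          ŵ (fun b : ↥(Set.toFinite (B10Eq42TorusConstraint.bondsIn j ((s.init.Λ (j + 1))ᶜ ∩ s.init.Ω (j + 1)))).toFinset => (ω j).2 b)) ∧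
    (Measurable (fun ω : MultiCfg (F.P p.K) (SU N) (FluctV N) => sect2Operand F N (FluctV N) p.K (settingOfRecord₁₃ F N θ.toStage13Params p) (θ.rzAt p s.init) s.init t Ek
                (UbgOfRecord₁₃CoP F N θ.toStage13Params p k s.init) (S, fun j => (ω j).2) (fun j => (ω j).1)) ∧
      ∃ CΦ : ℝ, ∀ a U, sect2Operand F N (FluctV N) p.K (settingOfRecord₁₃ F N θ.toStage13Params p) (θ.rzAt p s.init) s.init t Ek
                (UbgOfRecord₁₃CoP F N θ.toStage13Params p k s.init) a U ≤ CΦ) := by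
  have hWlaws : (WtOfRecord₁₃H F N (rePinH θ) p s).Laws := WtOfRecord₁₃H_laws (provisos₁₃CoPH_rePinH h).zhLaws p s
  refine ⟨fun j => ?_, ?_, ⟨Real.exp (-Ek), fun a U => ?_⟩⟩
  · -- the A-fibre of generation `j` is a one-point space
    haveI : IsEmpty ↥(Set.toFinite (B10Eq42TorusConstraint.bondsIn j ((s.init.Λ (j + 1))ᶜ ∩ s.init.Ω (j + 1)))).toFinset := by
      rw [sA_init_eq_empty_of_allLarge θ p s hall j]
      infer_instance
    refine ⟨fun _ => 1, measurable_const, ?_, fun ω => ?_⟩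
    · rw [lintegral_const, Measure.pi_empty_univ, mul_one]
      exact ENNReal.one_ne_top
    · rw [← ENNReal.ofReal_one]
      refine ENNReal.ofReal_le_ofReal (TkWeights.w_le_one hWlaws j _ _ _ ω ?_)
      exact le_rfl
  · exact BalabanUVNodesN11DiagonalOldBranchMeasurable.measurable_sect2Operand_CoP_of_allLarge θ.toStage13Params p hM s.init
      (BalabanUVNodesN11NoExpansionAllLargeCoP.init_allLarge θ.toStage13Params p s hall) (θ.rzAt p s.init) t Ek S
  · rw [BalabanUVNodesN11NoExpansionDiagonalCoPH.sect2Operand_congr_residual (settingOfRecord₁₃ F N θ.toStage13Params p) (θ.rzAt p s.init) (θ.Rz p.K)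
        s.init t Ek (UbgOfRecord₁₃CoP F N θ.toStage13Params p k s.init)]
    have e : sect2Operand F N (FluctV N) p.K (settingOfRecord₁₃ F N θ.toStage13Params p) (θ.Rz p.K) s.init t Ek
          (UbgOfRecord₁₃CoP F N θ.toStage13Params p k s.init) a U =
        Real.exp (-(1 / (gOfRecord₁₃ F N θ.toStage13Params p 0) ^ 2 * wilsonAction4 (U 0)) - Ek) :=
      BalabanUVNodesN11NoExpansionAllLargeCoP.sect2Operand_CoP_eq_of_allLarge θ.toStage13Params p hM s.init
        (BalabanUVNodesN11NoExpansionAllLargeCoP.init_allLarge θ.toStage13Params p s hall) t Ek a (fun j => (U j, (0 : VecField (F.P p.K) j (FluctV N))))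
    rw [e]
    refine Real.exp_le_exp.mpr ?_
    have h1 : 0 ≤ 1 / (gOfRecord₁₃ F N θ.toStage13Params p 0) ^ 2 * wilsonAction4 (U 0) := mul_nonneg (by positivity) (wilsonAction4_nonneg _)
    linarith

end Diagonal

end Summit.QuantumFields.YangMills.Theorems.BalabanUVNodesN11OldBranchIntegrableOfDominated

end
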